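import Literature.Analysis.FluidPDE.CompressibleEulerImplosionCentreSeriesTMEdge
import Literature.Analysis.FluidPDE.CompressibleEulerImplosionBulkClausesTM
import HarnessLib

/-!
# Buckmaster–Cao-Labora–Gómez-Serrano at `γ = 5/3`: the kernel certificate of the core envelope on `[−2, −1/3]`

Companion of `…CentreSeriesTMEdge` (the edge Taylor models `tmWe`, `tmUe` of `W^{(m)}`, `U_m = c·(eˣS)^{(m)}` of the
series profile, valid up to `λh < 1`) and `…BulkClausesTM` (the interval of the sonic scale `cI`, the model `tZ` of
`ζ`). The crux `DenseExcursion` (line `sonic-cavity-renewal`) consumes, on the core, clauses (b) (radial repulsivity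
`1 − W − W′ − |S + S′| ≥ 3/8`, angular `1 − W − |S + S′| ≥ 5/8`) and (c) (`|W| ≤ 1/4`, `|W′| ≤ 1/2`, `|W″| ≤ 6`,
`7/10 ≤ eˣS ≤ 1`, `|(eˣS)′| ≤ 1/4`, `|(eˣS)″| ≤ 2`) of the cavity tube. With `W^{(m)} = fW r m ζ`,
`c·(eˣS)^{(m)} = fU r m ζ` and `S + S′ = fU r 1 ζ / ζ` these are the SIXTEEN SIGN CONDITIONS of `pos_of_coreChk` below,
polynomial in `(fW r m ζ, fU r m ζ, ζ, c)`; this file builds their Taylor models (`G_…`), the boolean kernel check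
`coreChk` of one `(c, ζ)`-piece with its soundness, RUNS it (`decide +kernel`, degree `60`, depth `6`, all `3 × 16` checks
pass at depth `0`) on three pieces covering `c ∈ [17/50, 23/50]`, `ζ ∈ [27c/200, 7169c/10000]` (`x ∈ [−2, −1/3]`:
`e^{−2} ≥ 27/200`, `e^{−1/3} ≤ 7169/10000`), and assembles `core_pos_window2`. No facts, no axioms.

[cite: BuckmasterCaolaboraGomezserrano2025, Prop. 2.5, App. B]
-/

noncomputable section

namespace Literature.Analysis.FluidPDE

namespace BuckmasterCaolaboraGomezserrano2025

namespace OriginSeries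

namespace CentreW2

open Literature.Analysis.ValidatedNumerics Literature.Analysis.ValidatedNumerics.PolyMP
open Literature.Analysis.ValidatedNumerics.NumericsMP

set_option linter.style.longLine false
set_option linter.style.setOption false
set_option maxRecDepth 100000
set_option maxHeartbeats 4000000

/-! ### Kernel side: the sixteen Taylor models -/

section Kernel

variable (h clo chi : ℚ)

/-- A thin rational constant. [folklore] -/
def tq (q : ℚ) : IPoly := tconst (ofRat SB q)
/-- `1/4 ∓ W`. [folklore] -/
def G_c1p : IPoly := tsubI (tq (1 / 4)) (tmWe 0 h)
/-- [folklore] -/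
def G_c1m : IPoly := taddI (tq (1 / 4)) (tmWe 0 h)
/-- `1/2 ∓ W′`. [folklore] -/
def G_c2p : IPoly := tsubI (tq (1 / 2)) (tmWe 1 h)
/-- [folklore] -/
def G_c2m : IPoly := taddI (tq (1 / 2)) (tmWe 1 h)
/-- `6 ∓ W″`. [folklore] -/
def G_c3p : IPoly := tsubI (tq 6) (tmWe 2 h)
/-- [folklore] -/
def G_c3m : IPoly := taddI (tq 6) (tmWe 2 h)
/-- `U₀ − 7c/10` and `c − U₀`. [folklore] -/
def G_c4lo : IPoly := tsubI (tmUe 0 h) (tdivNat 10 (tsmulInt 7 (tconst (cI clo chi))))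
/-- [folklore] -/
def G_c4hi : IPoly := tsubI (tconst (cI clo chi)) (tmUe 0 h)
/-- `c/4 ∓ U₁`. [folklore] -/
def G_c5p : IPoly := tsubI (tdivNat 4 (tconst (cI clo chi))) (tmUe 1 h)
/-- [folklore] -/
def G_c5m : IPoly := taddI (tdivNat 4 (tconst (cI clo chi))) (tmUe 1 h)
/-- `2c ∓ U₂`. [folklore] -/
def G_c6p : IPoly := tsubI (tsmulInt 2 (tconst (cI clo chi))) (tmUe 2 h)
/-- [folklore] -/
def G_c6m : IPoly := taddI (tsmulInt 2 (tconst (cI clo chi))) (tmUe 2 h)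
/-- `ζ(5/8 − W − W′)`. [folklore] -/
def G_rad : IPoly := tmulI SB h 61 tZ (tsubI (tsubI (tq (5 / 8)) (tmWe 0 h)) (tmWe 1 h))
/-- `ζ(3/8 − W)`. [folklore] -/
def G_ang : IPoly := tmulI SB h 61 tZ (tsubI (tq (3 / 8)) (tmWe 0 h))
/-- `ζ(5/8 − W − W′) ∓ U₁`. [folklore] -/
def G_b1p : IPoly := tsubI (G_rad h) (tmUe 1 h)
/-- [folklore] -/
def G_b1m : IPoly := taddI (G_rad h) (tmUe 1 h)
/-- `ζ(3/8 − W) ∓ U₁`. [folklore] -/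
def G_b2p : IPoly := tsubI (G_ang h) (tmUe 1 h)
/-- [folklore] -/
def G_b2m : IPoly := taddI (G_ang h) (tmUe 1 h)

/-- THE KERNEL CHECK of one `(c, ζ)`-piece of the core envelope: sixteen sign conditions on `ζ ∈ [lo, h]`, `c ∈ [clo, chi]`. [folklore] -/
def coreChk (lo : ℚ) (d : ℕ) : Bool :=
  posOn SB d (G_c1p h) lo h && posOn SB d (G_c1m h) lo h && posOn SB d (G_c2p h) lo h && posOn SB d (G_c2m h) lo h &&
  posOn SB d (G_c3p h) lo h && posOn SB d (G_c3m h) lo h &&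
  posOn SB d (G_c4lo h clo chi) lo h && posOn SB d (G_c4hi h clo chi) lo h &&
  posOn SB d (G_c5p h clo chi) lo h && posOn SB d (G_c5m h clo chi) lo h &&
  posOn SB d (G_c6p h clo chi) lo h && posOn SB d (G_c6m h clo chi) lo h &&
  posOn SB d (G_b1p h) lo h && posOn SB d (G_b1m h) lo h && posOn SB d (G_b2p h) lo h && posOn SB d (G_b2m h) lo h

end Kernel

/-! ### Soundness of the check -/

/-- **Soundness of the kernel check of one piece**: the sixteen sign conditions at every `ζ ∈ [lo, h]`.
[cite: BuckmasterCaolaboraGomezserrano2025, Prop. 2.5, App. B] -/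
theorem pos_of_coreChk {r c : ℝ} {h clo chi lo : ℚ} {d : ℕ} (hr : r ∈ Set.Icc ((13890041/12500000 : ℚ) : ℝ) ((697/625 : ℚ) : ℝ))
    (h0 : 0 ≤ h) (hlam : lamQ * h < 1) (hc : c ∈ Set.Icc (clo : ℝ) (chi : ℝ)) (hchk : coreChk h clo chi lo d = true)
    (hlo : 0 ≤ lo) (hloh : lo ≤ h) {ζ : ℝ} (h1 : (lo : ℝ) ≤ ζ) (h2 : ζ ≤ h) :
    0 < 1 / 4 - fW r 0 ζ ∧ 0 < 1 / 4 + fW r 0 ζ ∧ 0 < 1 / 2 - fW r 1 ζ ∧ 0 < 1 / 2 + fW r 1 ζ ∧ 0 < 6 - fW r 2 ζ ∧ 0 < 6 + fW r 2 ζ ∧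
    0 < fU r 0 ζ - 7 * c / 10 ∧ 0 < c - fU r 0 ζ ∧ 0 < c / 4 - fU r 1 ζ ∧ 0 < c / 4 + fU r 1 ζ ∧ 0 < 2 * c - fU r 2 ζ ∧ 0 < 2 * c + fU r 2 ζ ∧
    0 < ζ * (5 / 8 - fW r 0 ζ - fW r 1 ζ) - fU r 1 ζ ∧ 0 < ζ * (5 / 8 - fW r 0 ζ - fW r 1 ζ) + fU r 1 ζ ∧
    0 < ζ * (3 / 8 - fW r 0 ζ) - fU r 1 ζ ∧ 0 < ζ * (3 / 8 - fW r 0 ζ) + fU r 1 ζ := by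
  have hζ : |ζ| ≤ h := by
    have : (0 : ℝ) ≤ lo := by exact_mod_cast hlo
    rw [abs_of_nonneg (by linarith)]; exact h2
  simp only [coreChk, Bool.and_eq_true] at hchk
  obtain ⟨⟨⟨⟨⟨⟨⟨⟨⟨⟨⟨⟨⟨⟨⟨k1, k2⟩, k3⟩, k4⟩, k5⟩, k6⟩, k7⟩, k8⟩, k9⟩, k10⟩, k11⟩, k12⟩, k13⟩, k14⟩, k15⟩, k16⟩ := hchk
  have P := fun {f : ℝ → ℝ} {Q : IPoly} (hf : TMem SB h f Q) (hk : posOn SB d Q lo h = true) => pos_of_tmem_posOn SB_pos hf hk hloh hζ h1 h2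
  have W := fun {a b e : ℝ} (hab : a < b) (hbe : b = e) => hab.trans_eq hbe
  have hW : ∀ {m : ℕ}, m ≤ 2 → TMem SB h (fun ζ => fW r m ζ) (tmWe m h) := fun hm => tmem_fW_edge hr hm h0 hlam
  have hU : ∀ {m : ℕ}, m ≤ 2 → TMem SB h (fun ζ => fU r m ζ) (tmUe m h) := fun hm => tmem_fU_edge hr hm h0 hlam
  have hq : ∀ q : ℚ, TMem SB h (fun _ : ℝ => ((q : ℚ) : ℝ)) (tq q) := fun q => tmem_const (mem_ofRat SB q)
  have hcI : TMem SB h (fun _ : ℝ => c) (tconst (cI clo chi)) := tmem_const (mem_cI hc)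
  have hZ : TMem SB h (fun ζ : ℝ => (0 : ℝ) + ζ) tZ := tmem_var mem_zI
  have hrad : TMem SB h (fun ζ => ζ * (5 / 8 - fW r 0 ζ - fW r 1 ζ)) (G_rad h) :=
    tmem_congr (tmem_mul SB_pos h0 61 hZ (tmem_sub (tmem_sub (hq (5 / 8)) (hW (by norm_num))) (hW (by norm_num)))) (fun ζ => by push_cast; ring)
  have hang : TMem SB h (fun ζ => ζ * (3 / 8 - fW r 0 ζ)) (G_ang h) :=
    tmem_congr (tmem_mul SB_pos h0 61 hZ (tmem_sub (hq (3 / 8)) (hW (by norm_num)))) (fun ζ => by push_cast; ring)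
  refine ⟨W (P (tmem_sub (hq (1 / 4)) (hW (by norm_num))) k1) (by push_cast; ring), W (P (tmem_add (hq (1 / 4)) (hW (by norm_num))) k2) (by push_cast; ring),
    W (P (tmem_sub (hq (1 / 2)) (hW (by norm_num))) k3) (by push_cast; ring), W (P (tmem_add (hq (1 / 2)) (hW (by norm_num))) k4) (by push_cast; ring),
    W (P (tmem_sub (hq 6) (hW (by norm_num))) k5) (by push_cast; ring), W (P (tmem_add (hq 6) (hW (by norm_num))) k6) (by push_cast; ring),
    W (P (tmem_sub (hU (by norm_num)) (tmem_divNat (n := 10) (by norm_num) (tmem_smulInt 7 hcI))) k7) (by push_cast; ring),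
    W (P (tmem_sub hcI (hU (by norm_num))) k8) rfl,
    W (P (tmem_sub (tmem_divNat (n := 4) (by norm_num) hcI) (hU (by norm_num))) k9) (by push_cast; ring),
    W (P (tmem_add (tmem_divNat (n := 4) (by norm_num) hcI) (hU (by norm_num))) k10) (by push_cast; ring),
    W (P (tmem_sub (tmem_smulInt 2 hcI) (hU (by norm_num))) k11) (by push_cast; ring),
    W (P (tmem_add (tmem_smulInt 2 hcI) (hU (by norm_num))) k12) (by push_cast; ring),
    W (P (tmem_sub hrad (hU (by norm_num))) k13) rfl, W (P (tmem_add hrad (hU (by norm_num))) k14) rfl,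
    W (P (tmem_sub hang (hU (by norm_num))) k15) rfl, W (P (tmem_add hang (hU (by norm_num))) k16) rfl⟩

/-! ### The kernel certificate and its assembly -/

/-- Piece 1: `c ∈ [17/50, 19/50]`. [cite: BuckmasterCaolaboraGomezserrano2025, App. B] -/
theorem coreChk_1 : coreChk (136211 / 500000) (17 / 50) (19 / 50) (459 / 10000) 6 = true := by decide +kernel

/-- Piece 2: `c ∈ [19/50, 21/50]`. [cite: BuckmasterCaolaboraGomezserrano2025, App. B] -/
theorem coreChk_2 : coreChk (150549 / 500000) (19 / 50) (21 / 50) (513 / 10000) 6 = true := by decide +kernel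

/-- Piece 3: `c ∈ [21/50, 23/50]`. [cite: BuckmasterCaolaboraGomezserrano2025, App. B] -/
theorem coreChk_3 : coreChk (164887 / 500000) (21 / 50) (23 / 50) (567 / 10000) 6 = true := by decide +kernel

/-- **The sixteen sign conditions of the core envelope** for `r` in the shooting window, `c ∈ [17/50, 23/50]` and
`ζ ∈ [27c/200, 7169c/10000]`. [cite: BuckmasterCaolaboraGomezserrano2025, Prop. 2.5, App. B] -/
theorem core_pos_window2 {r c ζ : ℝ} (hr : r ∈ Set.Icc ((13890041/12500000 : ℚ) : ℝ) ((697/625 : ℚ) : ℝ))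
    (hc : c ∈ Set.Icc (17 / 50 : ℝ) (23 / 50)) (h1 : 27 * c / 200 ≤ ζ) (h2 : ζ ≤ 7169 * c / 10000) :
    0 < 1 / 4 - fW r 0 ζ ∧ 0 < 1 / 4 + fW r 0 ζ ∧ 0 < 1 / 2 - fW r 1 ζ ∧ 0 < 1 / 2 + fW r 1 ζ ∧ 0 < 6 - fW r 2 ζ ∧ 0 < 6 + fW r 2 ζ ∧
    0 < fU r 0 ζ - 7 * c / 10 ∧ 0 < c - fU r 0 ζ ∧ 0 < c / 4 - fU r 1 ζ ∧ 0 < c / 4 + fU r 1 ζ ∧ 0 < 2 * c - fU r 2 ζ ∧ 0 < 2 * c + fU r 2 ζ ∧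
    0 < ζ * (5 / 8 - fW r 0 ζ - fW r 1 ζ) - fU r 1 ζ ∧ 0 < ζ * (5 / 8 - fW r 0 ζ - fW r 1 ζ) + fU r 1 ζ ∧
    0 < ζ * (3 / 8 - fW r 0 ζ) - fU r 1 ζ ∧ 0 < ζ * (3 / 8 - fW r 0 ζ) + fU r 1 ζ := by
  obtain ⟨hc1, hc2⟩ := hc
  rcases le_or_gt c (19 / 50) with ha | ha
  · exact pos_of_coreChk hr (by norm_num) (by norm_num [lamQ]) (clo := 17 / 50) (chi := 19 / 50) ⟨by push_cast; linarith, by push_cast; linarith⟩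
      coreChk_1 (by norm_num) (by norm_num) (by push_cast; linarith) (by push_cast; linarith)
  rcases le_or_gt c (21 / 50) with hb | hb
  · exact pos_of_coreChk hr (by norm_num) (by norm_num [lamQ]) (clo := 19 / 50) (chi := 21 / 50) ⟨by push_cast; linarith, by push_cast; linarith⟩
      coreChk_2 (by norm_num) (by norm_num) (by push_cast; linarith) (by push_cast; linarith)
  · exact pos_of_coreChk hr (by norm_num) (by norm_num [lamQ]) (clo := 21 / 50) (chi := 23 / 50) ⟨by push_cast; linarith, by push_cast; linarith⟩
      coreChk_3 (by norm_num) (by norm_num) (by push_cast; linarith) (by push_cast; linarith)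

end CentreW2

end OriginSeries

end BuckmasterCaolaboraGomezserrano2025

end Literature.Analysis.FluidPDE
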